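import Mathlib.LinearAlgebra.TensorProduct.Associator
import Mathlib.LinearAlgebra.Matrix.Nondegenerate
import Mathlib.LinearAlgebra.Matrix.Determinant.Basic
import Mathlib.Algebra.Polynomial.BigOperators
import Mathlib.Algebra.Polynomial.Roots
import Mathlib.Algebra.Polynomial.AlgebraMap
import Mathlib.Analysis.Complex.Polynomial.Basic
import Literature.RepresentationTheory.Virasoro.HighestWeightModule
import Literature.RepresentationTheory.Virasoro.FockModule

/-!
# The PBW theorem for Verma modules over the Virasoro algebra: `dim V(c,h)_{h+N} = p(N)`

We prove that the ordered PBW monomials `e_𝕀 v_{c,h} = L_{-k₁} ⋯ L_{-k_j} v_{c,h}` (`𝕀 ⊢ N`) of the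
Verma module `V(c,h)` are linearly independent (`Verma.linearIndependent_partitionVector`), hence
form a basis of the weight space `V(c,h)_{h+N}` and

  `dim V(c,h)_{h+N} = p(N)`     (`Verma.gradedDim_eq_card`),

i.e. `ch V(c,h) = q^h / ∏_{n ≥ 1} (1 - qⁿ)` (Kytölä–Ridout eq. (2.8); Iohara–Koga §4.4.2 "forms a
basis of the weight subspace M(c,h)_{h+n}"; Di Francesco–Mathieu–Sénéchal eq. (7.10)), for ALL
`c, h ∈ ℂ`.

## The proof (Fock modules and a generic-charge argument)

By the universal property (`Verma.lift`) it suffices to find ONE representation with a primary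
vector `w` of weight `h` and central charge `c` on which the words `e_𝕀 w` are independent
(`Verma.linearIndependent_partitionVector_of_isPrimary`).

* Tensor products of representations add central charges and weights of primary vectors
  (`VirasoroRep.tensor`, `IsPrimary.tmul`), and independence of the `e_𝕀 (w₁ ⊗ w₂)` follows from
  that of the `e_𝕀 w₁` as soon as the second factor has a linear form `ε` with `ε w₂ = 1` killing
  the range of every `L_{-k}`, `k ≥ 1` (project with `id ⊗ ε`, `VirasoroRep.tensorProj_partitionVector`).
* The Feigin–Fuchs Fock modules `F_λ^μ` (`Literature.RepresentationTheory.Virasoro.FockModule`)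
  supply, over `ℂ`, a primary vacuum of every weight at every central charge, with `ε` = the vacuum
  component; so `W = F_0^{μ₀} ⊗ F_{λ₂}^{μ₂}` does it once the words `e_𝕀 |μ₀⟩` are independent in
  `F_0^{μ₀}` for a suitable `μ₀`.
* Genericity in `μ₀`: over `R = ℂ[X]` (`μ = X`, `λ = 0`), `e_𝕀 |X⟩ = X^{ℓ(𝕀)} x_𝕀 + (lower degree in X)`
  (`Fock.coeff_pbwVector_generic`), so the `p(N) × p(N)` matrix of coefficients of the `e_𝕀|X⟩` on
  the monomials `x_𝕁` has a determinant which is a monic polynomial in `X` of degree `Σ_𝕀 ℓ(𝕀)`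
  (expansion over permutations); it has finitely many roots, and at every other `μ₀ ∈ ℂ` the
  specialised words are independent (`Fock.exists_linearIndependent_partitionVector`).

## Not here

The Shapovalov form / Kac determinant, singular vectors.
-/

noncomputable section

namespace Literature.RepresentationTheory.Virasoro

open scoped TensorProduct

/-! ### Tensor products of representations -/

/-- The central term is additive in the central charge. [folklore] -/
theorem centralTerm_add (c₁ c₂ : ℂ) (m n : ℤ) :
    centralTerm (c₁ + c₂) m n = centralTerm c₁ m n + centralTerm c₂ m n := by
  unfold centralTerm
  split_ifs <;> ring

namespace VirasoroRep

variable {c₁ c₂ : ℂ} {V₁ V₂ : Type*} [AddCommGroup V₁] [Module ℂ V₁] [AddCommGroup V₂] [Module ℂ V₂]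

/-- The **tensor product** of two representations of the Virasoro algebra, `L_n ↦ L_n ⊗ 1 + 1 ⊗ L_n`
(the coproduct of `U(Vir)`), a representation of central charge `c₁ + c₂` (stated for any
`c = c₁ + c₂` to avoid casts). [folklore] -/
def tensor (R₁ : VirasoroRep c₁ V₁) (R₂ : VirasoroRep c₂ V₂) (c : ℂ) (hc : c₁ + c₂ = c) :
    VirasoroRep c (V₁ ⊗[ℂ] V₂) where
  L n := TensorProduct.map (R₁.L n) LinearMap.id + TensorProduct.map LinearMap.id (R₂.L n)
  lie m n z := by
    subst hc
    induction z using TensorProduct.induction_on with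
    | zero => simp
    | tmul v w =>
      simp only [LinearMap.add_apply, TensorProduct.map_tmul, LinearMap.id_apply, map_add]
      rw [R₁.comm_apply m n v, R₂.comm_apply m n w, centralTerm_add]
      simp only [TensorProduct.add_tmul, TensorProduct.tmul_add, TensorProduct.smul_tmul',
        TensorProduct.tmul_smul, smul_add, add_smul]
      abel
    | add x y hx hy =>
      simp only [map_add, smul_add] at hx hy ⊢
      rw [add_sub_add_comm, hx, hy]
      abel

/-- Unfolding of the tensor product generators on pure tensors. [folklore] -/
theorem tensor_L_tmul (R₁ : VirasoroRep c₁ V₁) (R₂ : VirasoroRep c₂ V₂) (c : ℂ) (hc : c₁ + c₂ = c)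
    (n : ℤ) (v : V₁) (w : V₂) :
    (R₁.tensor R₂ c hc).L n (v ⊗ₜ w) = R₁.L n v ⊗ₜ w + v ⊗ₜ R₂.L n w := by
  simp [tensor]

/-- The tensor product of primary vectors is primary, of the sum of the weights. [folklore] -/
theorem IsPrimary.tmul {R₁ : VirasoroRep c₁ V₁} {R₂ : VirasoroRep c₂ V₂} {c : ℂ} {hc : c₁ + c₂ = c}
    {v : V₁} {w : V₂} {h₁ h₂ : ℂ} (hv : R₁.IsPrimary v h₁) (hw : R₂.IsPrimary w h₂) :
    (R₁.tensor R₂ c hc).IsPrimary (v ⊗ₜ w) (h₁ + h₂) := by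
  refine ⟨fun n hn => ?_, ?_⟩
  · rw [tensor_L_tmul, hv.annihilated n hn, hw.annihilated n hn, TensorProduct.zero_tmul,
      TensorProduct.tmul_zero, add_zero]
  · rw [tensor_L_tmul, hv.weight, hw.weight, ← TensorProduct.smul_tmul', TensorProduct.tmul_smul,
      ← add_smul]

/-- The projection `id ⊗ ε : V₁ ⊗ V₂ → V₁` along a linear form `ε` on the second factor. [folklore] -/
def tensorProj (ε : V₂ →ₗ[ℂ] ℂ) : V₁ ⊗[ℂ] V₂ →ₗ[ℂ] V₁ :=
  (TensorProduct.rid ℂ V₁).toLinearMap ∘ₗ TensorProduct.map LinearMap.id ε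

/-- `(id ⊗ ε)(v ⊗ w) = ε(w) v`. [folklore] -/
@[simp] theorem tensorProj_tmul (ε : V₂ →ₗ[ℂ] ℂ) (v : V₁) (w : V₂) :
    tensorProj (V₁ := V₁) ε (v ⊗ₜ w) = ε w • v := by
  simp [tensorProj]

/-- If `ε` kills the range of `L_{-k}` on the second factor, then `id ⊗ ε` intertwines the `L_{-k}`
of the tensor product and of the first factor. [folklore] -/
theorem tensorProj_L (R₁ : VirasoroRep c₁ V₁) (R₂ : VirasoroRep c₂ V₂) (c : ℂ) (hc : c₁ + c₂ = c)
    (ε : V₂ →ₗ[ℂ] ℂ) {n : ℤ} (hε : ∀ w, ε (R₂.L n w) = 0) (z : V₁ ⊗[ℂ] V₂) :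
    tensorProj ε ((R₁.tensor R₂ c hc).L n z) = R₁.L n (tensorProj ε z) := by
  induction z using TensorProduct.induction_on with
  | zero => simp
  | tmul v w => rw [tensor_L_tmul, map_add, tensorProj_tmul, tensorProj_tmul, tensorProj_tmul, hε,
      zero_smul, add_zero, map_smul]
  | add x y hx hy => rw [map_add, map_add, hx, hy, map_add, map_add]

/-- Words are linear in the vector. [folklore] -/
theorem pbwVector_smul {c : ℂ} {V : Type*} [AddCommGroup V] [Module ℂ V] (R : VirasoroRep c V)
    (l : List ℕ) (a : ℂ) (v : V) : R.pbwVector l (a • v) = a • R.pbwVector l v := by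
  induction l with
  | nil => rfl
  | cons k l ih => rw [pbwVector_cons, pbwVector_cons, ih, map_smul]

/-- Hence, if `ε` kills the ranges of all `L_{-k}`, `k ≥ 1`, `id ⊗ ε` maps the word
`L_{-k₁} ⋯ L_{-k_j} z` (`kᵢ ≥ 1`) to `L_{-k₁} ⋯ L_{-k_j} (id ⊗ ε)(z)`. [folklore] -/
theorem tensorProj_pbwVector (R₁ : VirasoroRep c₁ V₁) (R₂ : VirasoroRep c₂ V₂) (c : ℂ)
    (hc : c₁ + c₂ = c) (ε : V₂ →ₗ[ℂ] ℂ) (hε : ∀ k : ℕ, 0 < k → ∀ w, ε (R₂.L (-(k : ℤ)) w) = 0)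
    {l : List ℕ} (hl : ∀ k ∈ l, 0 < k) (z : V₁ ⊗[ℂ] V₂) :
    tensorProj ε ((R₁.tensor R₂ c hc).pbwVector l z) = R₁.pbwVector l (tensorProj ε z) := by
  induction l with
  | nil => rfl
  | cons k l ih =>
    rw [pbwVector_cons, pbwVector_cons,
      tensorProj_L R₁ R₂ c hc ε (hε k (hl k List.mem_cons_self)),
      ih fun j hj => hl j (List.mem_cons_of_mem k hj)]

/-- **Projection of PBW monomials**: `(id ⊗ ε)(e_𝕀 (v ⊗ w)) = ε(w) e_𝕀 v` when `ε` kills the ranges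
of the `L_{-k}`, `k ≥ 1`, of the second factor. [folklore] -/
theorem tensorProj_partitionVector (R₁ : VirasoroRep c₁ V₁) (R₂ : VirasoroRep c₂ V₂) (c : ℂ)
    (hc : c₁ + c₂ = c) (ε : V₂ →ₗ[ℂ] ℂ) (hε : ∀ k : ℕ, 0 < k → ∀ w, ε (R₂.L (-(k : ℤ)) w) = 0)
    {N : ℕ} (p : Nat.Partition N) (v : V₁) (w : V₂) :
    tensorProj ε ((R₁.tensor R₂ c hc).partitionVector p (v ⊗ₜ w)) = ε w • R₁.partitionVector p v := by
  unfold partitionVector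
  rw [tensorProj_pbwVector R₁ R₂ c hc ε hε ?_ (v ⊗ₜ w), tensorProj_tmul, pbwVector_smul]
  intro k hk
  rw [List.mem_reverse, Multiset.mem_sort] at hk
  exact p.parts_pos hk

/-- **Independence descends along `id ⊗ ε`**: if the `e_𝕀 v`, `𝕀 ⊢ N`, are linearly independent
in `V₁` and `ε(w) = 1`, the `e_𝕀 (v ⊗ w)` are linearly independent in `V₁ ⊗ V₂`. [folklore] -/
theorem linearIndependent_partitionVector_tmul (R₁ : VirasoroRep c₁ V₁) (R₂ : VirasoroRep c₂ V₂)
    (c : ℂ) (hc : c₁ + c₂ = c) (ε : V₂ →ₗ[ℂ] ℂ)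
    (hε : ∀ k : ℕ, 0 < k → ∀ w, ε (R₂.L (-(k : ℤ)) w) = 0) {N : ℕ} {v : V₁} {w : V₂} (hw : ε w = 1)
    (hind : LinearIndependent ℂ fun p : Nat.Partition N => R₁.partitionVector p v) :
    LinearIndependent ℂ fun p : Nat.Partition N => (R₁.tensor R₂ c hc).partitionVector p (v ⊗ₜ w) := by
  refine LinearIndependent.of_comp (tensorProj ε) ?_
  convert hind using 1
  ext p
  simp [tensorProj_partitionVector R₁ R₂ c hc ε hε, hw]

end VirasoroRep

/-! ### Transfer to the Verma module along the universal property -/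

namespace Verma

variable {c h : ℂ} {W : Type*} [AddCommGroup W] [Module ℂ W] (S : VirasoroRep c W) {w : W}

/-- The universal map sends words to words. [cite: IoharaKoga2011, Proposition 1.6 (1)] -/
theorem lift_pbwVector (hw' : S.IsPrimary w h) (l : List ℕ) (x : Verma c h) :
    lift S hw' ((rep c h).pbwVector l x) = S.pbwVector l (lift S hw' x) := by
  induction l with
  | nil => rfl
  | cons k l ih => rw [VirasoroRep.pbwVector_cons, VirasoroRep.pbwVector_cons, lift_L, ih]

/-- The universal map sends `e_𝕀 v_{c,h}` to `e_𝕀 w`. [cite: IoharaKoga2011, Proposition 1.6 (1)] -/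
theorem lift_partitionVector (hw' : S.IsPrimary w h) {N : ℕ} (p : Nat.Partition N) :
    lift S hw' ((rep c h).partitionVector p (hw c h)) = S.partitionVector p w := by
  unfold VirasoroRep.partitionVector
  rw [lift_pbwVector, lift_hw]

/-- **Independence in any highest-weight representation forces independence in the Verma
module**: if some representation of central charge `c` has a primary vector `w` of weight `h` on
which the PBW monomials `e_𝕀 w`, `𝕀 ⊢ N`, are linearly independent, then so are the
`e_𝕀 v_{c,h}` in `V(c,h)`. [cite: IoharaKoga2011, Proposition 1.6 (1) and §4.4.2] -/
theorem linearIndependent_partitionVector_of_isPrimary (hw' : S.IsPrimary w h) {N : ℕ}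
    (hind : LinearIndependent ℂ fun p : Nat.Partition N => S.partitionVector p w) :
    LinearIndependent ℂ fun p : Nat.Partition N => (rep c h).partitionVector p (hw c h) := by
  refine LinearIndependent.of_comp (lift S hw') ?_
  convert hind using 1
  ext p
  simp [lift_partitionVector]

end Verma

/-! ### Genericity: the words `e_𝕀 |X⟩` in the Fock module `F_0^X` over `ℂ[X]` -/

namespace Fock

open Polynomial

/-- The generic-charge Fock module `F_0^X` over `ℂ[X]` (`λ = 0`, `a_0 = X`), of central charge `1`.
[cite: IoharaKoga2011, §4.1] -/
abbrev genRep : VirasoroRep (1 - 12 * (0 : ℂ) ^ 2) (Space ℂ[X]) := rep (R := ℂ[X]) 0 Polynomial.X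

/-- The exponent vector `x_{k₁} ⋯ x_{k_j} ↦ Σ e_{kᵢ}` of a word in positive letters. [folklore] -/
def monoOf (l : List ℕ) : ℕ+ →₀ ℕ := Multiset.toFinsupp ((l.map Nat.toPNat' : List ℕ+) : Multiset ℕ+)

/-- `monoOf [] = 0`. [folklore] -/
@[simp] theorem monoOf_nil : monoOf [] = 0 := by simp [monoOf]

/-- `monoOf (k :: l) = e_k + monoOf l`. [folklore] -/
theorem monoOf_cons (k : ℕ) (l : List ℕ) :
    monoOf (k :: l) = Finsupp.single (Nat.toPNat' k) 1 + monoOf l := by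
  rw [monoOf, monoOf, List.map_cons, ← Multiset.cons_coe, ← Multiset.singleton_add,
    Multiset.toFinsupp_add, Multiset.toFinsupp_singleton]

/-- The exponent vector only depends on the underlying multiset. [folklore] -/
theorem monoOf_eq_of_perm {l l' : List ℕ} (h : l.Perm l') : monoOf l = monoOf l' := by
  rw [monoOf, monoOf, Multiset.coe_eq_coe.mpr (h.map _)]

/-- On words in positive letters the exponent vector determines the multiset of letters. [folklore] -/
theorem coe_eq_of_monoOf_eq {l l' : List ℕ} (hl : ∀ k ∈ l, 0 < k) (hl' : ∀ k ∈ l', 0 < k)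
    (h : monoOf l = monoOf l') : (l : Multiset ℕ) = l' := by
  have h1 : ((l.map Nat.toPNat' : List ℕ+) : Multiset ℕ+) = (l'.map Nat.toPNat' : List ℕ+) :=
    Multiset.toFinsupp.injective h
  have h2 : ∀ l : List ℕ, (∀ k ∈ l, 0 < k) → (l.map Nat.toPNat').map PNat.val = l := by
    intro l hl
    rw [List.map_map]
    conv_rhs => rw [← List.map_id l]
    refine List.map_congr_left fun k hk => ?_
    show ((Nat.toPNat' k : ℕ)) = id k
    rw [Nat.toPNat'_coe, if_pos (hl k hk), id]
  have h3 := congrArg (Multiset.map PNat.val) h1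
  rw [Multiset.map_coe, Multiset.map_coe, h2 l hl, h2 l' hl'] at h3
  exact h3

/-- Bounded `X`-degree of all coefficients of a polynomial over `ℂ[X]`. [folklore] -/
def DegLE (D : ℕ) (q : Space ℂ[X]) : Prop := ∀ t, (MvPolynomial.coeff t q).degree ≤ D

/-- Polynomials extended from `ℂ` have constant coefficients. [folklore] -/
theorem degLE_zero_map (r : Space ℂ) : DegLE 0 (MvPolynomial.map Polynomial.C r) := by
  intro t
  rw [MvPolynomial.coeff_map, Nat.cast_zero]
  exact Polynomial.degree_C_le

/-- `DegLE` is monotone. [folklore] -/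
theorem DegLE.mono {D D' : ℕ} (h : D ≤ D') {q : Space ℂ[X]} (hq : DegLE D q) : DegLE D' q :=
  fun t => (hq t).trans (by exact_mod_cast h)

/-- Sums. [folklore] -/
theorem DegLE.add {D : ℕ} {q q' : Space ℂ[X]} (hq : DegLE D q) (hq' : DegLE D q') : DegLE D (q + q') := by
  intro t
  rw [MvPolynomial.coeff_add]
  exact (degree_add_le _ _).trans (max_le (hq t) (hq' t))

/-- Finite sums. [folklore] -/
theorem DegLE.sum {D : ℕ} {ι : Type*} (s : Finset ι) {f : ι → Space ℂ[X]} (hf : ∀ i ∈ s, DegLE D (f i)) :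
    DegLE D (∑ i ∈ s, f i) := by
  classical
  induction s using Finset.induction_on with
  | empty => intro t; simp
  | insert a s ha ih =>
    rw [Finset.sum_insert ha]
    exact (hf a (Finset.mem_insert_self a s)).add (ih fun i hi => hf i (Finset.mem_insert_of_mem hi))

/-- Multiplication by a polynomial with constant coefficients preserves the bound. [folklore] -/
theorem DegLE.mul_left {D : ℕ} {f q : Space ℂ[X]} (hf : DegLE 0 f) (hq : DegLE D q) : DegLE D (f * q) := by
  intro t
  rw [MvPolynomial.coeff_mul]
  refine (degree_sum_le _ _).trans (Finset.sup_le fun x _ => ?_)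
  refine (degree_mul_le _ _).trans ?_
  have h1 := hf x.1
  have h2 := hq x.2
  calc (MvPolynomial.coeff x.1 f).degree + (MvPolynomial.coeff x.2 q).degree ≤ (0 : ℕ) + (D : WithBot ℕ) :=
        add_le_add h1 h2
    _ = D := by simp

/-- Scalar multiplication by a polynomial of degree `≤ 1` raises the bound by one. [folklore] -/
theorem DegLE.smul_X {D : ℕ} {q : Space ℂ[X]} (hq : DegLE D q) : DegLE (D + 1) ((Polynomial.X : ℂ[X]) • q) := by
  intro t
  rw [MvPolynomial.coeff_smul, smul_eq_mul, X_mul, degree_mul_X]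
  calc (MvPolynomial.coeff t q).degree + 1 ≤ (D : WithBot ℕ) + 1 := add_le_add (hq t) le_rfl
    _ = ((D + 1 : ℕ) : WithBot ℕ) := by push_cast; rfl

/-- The derivation part of the creation operators is defined over `ℂ` (indeed over `ℤ`): it does
not depend on `λ, μ` for `n < 0`. [folklore] -/
theorem D_eq_of_neg {R : Type*} [CommRing R] (lam mu lam' mu' : R) {n : ℤ} (hn : n < 0) :
    D R lam mu n = D R lam' mu' n := by
  unfold D
  congr 1
  funext i
  have : n ≠ ((i : ℕ) : ℤ) := by have := i.pos; omega
  simp [dc, this]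

/-- The derivation part of the creation operators preserves the coefficient degree bound. [folklore] -/
theorem DegLE.D_apply {D : ℕ} {q : Space ℂ[X]} (hq : DegLE D q) (lam mu : ℂ[X]) {n : ℤ} (hn : n < 0) :
    DegLE D (Fock.D ℂ[X] lam mu n q) := by
  rw [q.as_sum, map_sum]
  refine DegLE.sum _ fun t _ => ?_
  have h1 : (MvPolynomial.monomial t (MvPolynomial.coeff t q) : Space ℂ[X]) =
      MvPolynomial.coeff t q • MvPolynomial.map Polynomial.C (MvPolynomial.monomial t 1) := by
    rw [MvPolynomial.map_monomial, map_one, MvPolynomial.smul_monomial, smul_eq_mul, mul_one]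
  rw [h1, Derivation.map_smul, D_eq_of_neg lam mu (Polynomial.C 0) (Polynomial.C 0) hn,
    ← map_D 0 0 Polynomial.C n]
  intro u
  rw [MvPolynomial.coeff_smul, MvPolynomial.coeff_map, smul_eq_mul]
  refine (degree_mul_le _ _).trans ?_
  calc (MvPolynomial.coeff t q).degree +
        (Polynomial.C (MvPolynomial.coeff u (Fock.D ℂ 0 0 n (MvPolynomial.monomial t 1)))).degree
      ≤ (D : WithBot ℕ) + (0 : ℕ) := add_le_add (hq t) degree_C_le
    _ = D := by simp

/-- **The creation operators of `F_0^X`**: `L_{-k} q = X · x_k q + (½ Σ x_i x_{k-i}) q + D_{-k} q`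
(`k ≥ 1`; `λ = 0`, `a_0 = X`). [cite: IoharaKoga2011, eqs. (4.1)–(4.3)] -/
theorem genRep_L_neg_apply (k : ℕ) (hk : 0 < k) (q : Space ℂ[X]) :
    genRep.L (-(k : ℤ)) q =
      (Polynomial.X : ℂ[X]) • (x ℂ[X] k * q) + (quad ℂ[X] k * q + Fock.D ℂ[X] 0 Polynomial.X (-(k : ℤ)) q) := by
  have h0 : (-(k : ℤ)).toNat = 0 := by simp
  have h1 : (-(-(k : ℤ))).toNat = k := by simp
  rw [rep_L_apply, map_zero]
  simp only [L, LinearMap.add_apply, LinearMap.mulLeft_apply, Derivation.coeFn_coe, h0, aa_zero,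
    add_zero, if_neg (show (-(k : ℤ)) ≠ 0 by omega), zero_smul, P, h1,
    zero_mul, sub_zero, add_mul, smul_mul_assoc]
  abel

/-- **Leading term of the PBW words in the generic Fock module**: for a word `l = (k₁, …, k_j)` in
positive letters, the coefficient of the monomial `x_{k₁} ⋯ x_{k_j}` in `L_{-k₁} ⋯ L_{-k_j} |X⟩` is
`X^j +` (degree `< j`), and every other coefficient has `X`-degree `< j` (each `L_{-k}` contributes
its top term `a_{-k} a_0 = X x_k`, all other terms being `X`-free). [cite: IoharaKoga2011, Lemma 4.9 (h-degree count of the leading term, transported to F^η via a_0 = X)] -/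
theorem coeff_pbwVector_generic {l : List ℕ} (hl : ∀ k ∈ l, 0 < k) :
    (∃ r : ℂ[X], MvPolynomial.coeff (monoOf l) (genRep.pbwVector l 1) = Polynomial.X ^ l.length + r ∧
        r.degree < l.length) ∧
      (∀ t, t ≠ monoOf l → (MvPolynomial.coeff t (genRep.pbwVector l 1)).degree < l.length) := by
  induction l with
  | nil =>
    refine ⟨⟨0, by simp, by simp⟩, fun t ht => ?_⟩
    rw [VirasoroRep.pbwVector_nil, monoOf_nil] at *
    rw [MvPolynomial.coeff_one, if_neg (Ne.symm ht), degree_zero, List.length_nil]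
    exact WithBot.bot_lt_coe 0
  | cons k l ih =>
    have hk : 0 < k := hl k List.mem_cons_self
    obtain ⟨⟨r, hr, hrdeg⟩, hoff⟩ := ih fun j hj => hl j (List.mem_cons_of_mem k hj)
    set W := genRep.pbwVector l 1 with hW
    -- all coefficients of `W` have degree `≤ ℓ`
    have hWdeg : DegLE l.length W := by
      intro t
      by_cases ht : t = monoOf l
      · rw [ht, hr]
        refine (degree_add_le _ _).trans (max_le ?_ hrdeg.le)
        rw [degree_X_pow]
      · exact (hoff t ht).le
    -- the `X`-free part
    set T := quad ℂ[X] k * W + Fock.D ℂ[X] 0 Polynomial.X (-(k : ℤ)) W with hT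
    have hTdeg : DegLE l.length T := by
      refine DegLE.add ?_ (hWdeg.D_apply _ _ (by omega))
      refine DegLE.mul_left ?_ hWdeg
      rw [← map_quad (Algebra.ofId ℂ ℂ[X]) k]
      exact degLE_zero_map _
    have hstep : genRep.pbwVector (k :: l) 1 = (Polynomial.X : ℂ[X]) • (x ℂ[X] k * W) + T := by
      rw [VirasoroRep.pbwVector_cons, genRep_L_neg_apply k hk]
    -- coefficients of `x_k * W`
    have hxW : ∀ t, MvPolynomial.coeff t (x ℂ[X] k * W) =
        if Nat.toPNat' k ∈ t.support then MvPolynomial.coeff (t - Finsupp.single (Nat.toPNat' k) 1) W else 0 := by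
      intro t
      rw [x_of_pos hk, show (⟨k, hk⟩ : ℕ+) = Nat.toPNat' k from
          PNat.eq (by simp [Nat.toPNat'_coe, hk]), MvPolynomial.coeff_X_mul']
    refine ⟨⟨Polynomial.X * r + MvPolynomial.coeff (monoOf (k :: l)) T, ?_, ?_⟩, fun t ht => ?_⟩
    · rw [hstep, MvPolynomial.coeff_add, MvPolynomial.coeff_smul, smul_eq_mul, hxW, monoOf_cons, if_pos (by simp),
        add_tsub_cancel_left, hr, List.length_cons, pow_succ']
      ring
    · refine (degree_add_le _ _).trans_lt (max_lt ?_ ?_)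
      · rw [X_mul, degree_mul_X, List.length_cons, Nat.cast_add, Nat.cast_one]
        exact WithBot.add_lt_add_right WithBot.one_ne_bot hrdeg
      · exact (hTdeg _).trans_lt (by exact_mod_cast Nat.lt_succ_self _)
    · rw [hstep, MvPolynomial.coeff_add, MvPolynomial.coeff_smul, smul_eq_mul, hxW]
      refine (degree_add_le _ _).trans_lt (max_lt ?_ ?_)
      · split_ifs with hmem
        · have hne : t - Finsupp.single (Nat.toPNat' k) 1 ≠ monoOf l := by
            intro h
            apply ht
            rw [monoOf_cons, ← h, add_comm, Finsupp.sub_add_single_one_cancel]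
            exact Finsupp.mem_support_iff.mp hmem
          rw [X_mul, degree_mul_X, List.length_cons, Nat.cast_add, Nat.cast_one]
          exact WithBot.add_lt_add_right WithBot.one_ne_bot (hoff _ hne)
        · rw [mul_zero, degree_zero]
          exact WithBot.bot_lt_coe _
      · exact (hTdeg _).trans_lt (by exact_mod_cast Nat.lt_succ_self _)

/-- Specialisation `X ↦ μ₀` maps the words of `F_0^X` to those of `F_0^{μ₀}`. [folklore] -/
theorem map_pbwVector_genRep (μ₀ : ℂ) (l : List ℕ) :
    MvPolynomial.map (Polynomial.aeval μ₀ : ℂ[X] →ₐ[ℂ] ℂ) (genRep.pbwVector l 1) =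
      (rep (R := ℂ) 0 μ₀).pbwVector l 1 := by
  induction l with
  | nil => simp
  | cons k l ih =>
    rw [VirasoroRep.pbwVector_cons, VirasoroRep.pbwVector_cons, map_rep_L, ih, Polynomial.aeval_X]

/-- **Generic independence**: for every level `N` there is `μ₀ ∈ ℂ` (indeed all but finitely many)
such that the PBW words `e_𝕀 |μ₀⟩`, `𝕀 ⊢ N`, of the Fock module `F_0^{μ₀}` (`c = 1`, `h = μ₀²/2`)
are linearly independent: the determinant of their coefficients on the monomials `x_𝕁` is a monic
polynomial in `μ₀` of degree `Σ_𝕀 ℓ(𝕀)`. [cite: IoharaKoga2011, Lemma 4.9 and §4.4.2 (degree count of the diagonal term of a determinant)] -/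
theorem exists_linearIndependent_partitionVector (N : ℕ) :
    ∃ μ₀ : ℂ, LinearIndependent ℂ fun p : Nat.Partition N => (rep (R := ℂ) 0 μ₀).partitionVector p 1 := by
  classical
  -- data attached to a partition
  let lst : Nat.Partition N → List ℕ := fun p => (p.parts.sort (· ≤ ·)).reverse
  have hlst : ∀ p, ∀ k ∈ lst p, 0 < k := fun p k hk => by
    rw [List.mem_reverse, Multiset.mem_sort] at hk
    exact p.parts_pos hk
  have hlst_coe : ∀ p, (lst p : Multiset ℕ) = p.parts := fun p => by
    rw [Multiset.coe_reverse, Multiset.sort_eq]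
  let mo : Nat.Partition N → (ℕ+ →₀ ℕ) := fun p => monoOf (lst p)
  have hmo : Function.Injective mo := by
    intro p q h
    have h1 := coe_eq_of_monoOf_eq (hlst p) (hlst q) h
    rw [hlst_coe, hlst_coe] at h1
    exact Nat.Partition.ext h1
  let ℓ : Nat.Partition N → ℕ := fun p => (lst p).length
  -- the matrix of coefficients
  let A : Matrix (Nat.Partition N) (Nat.Partition N) ℂ[X] :=
    fun p q => MvPolynomial.coeff (mo q) (genRep.partitionVector p 1)
  have hA : ∀ p q, (p = q → ∃ r : ℂ[X], A p q = Polynomial.X ^ ℓ p + r ∧ r.degree < ℓ p) ∧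
      (p ≠ q → (A p q).degree < ℓ p) := by
    intro p q
    have h := coeff_pbwVector_generic (hlst p)
    refine ⟨fun hpq => ?_, fun hpq => ?_⟩
    · subst hpq; exact h.1
    · exact h.2 _ fun hh => hpq (hmo hh.symm)
  -- the diagonal entries are monic of degree `ℓ p`
  have hmon : ∀ p, (A p p).Monic ∧ (A p p).natDegree = ℓ p := by
    intro p
    obtain ⟨r, hr, hrdeg⟩ := (hA p p).1 rfl
    have hlt : r.degree < (Polynomial.X ^ ℓ p : ℂ[X]).degree := by rwa [degree_X_pow]
    rw [hr]
    exact ⟨(monic_X_pow _).add_of_left hlt,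
      by rw [natDegree_add_eq_left_of_degree_lt hlt, natDegree_X_pow]⟩
  have hdiag_monic : (∏ p, A p p).Monic := monic_prod_of_monic _ _ fun p _ => (hmon p).1
  have hdiag_deg : (∏ p, A p p).natDegree = ∑ p, ℓ p := by
    rw [natDegree_prod_of_monic _ _ fun p _ => (hmon p).1]
    exact Finset.sum_congr rfl fun p _ => (hmon p).2
  -- the other terms of the determinant have smaller degree
  have hoff : ∀ σ : Equiv.Perm (Nat.Partition N), σ ≠ 1 →
      (Equiv.Perm.sign σ • ∏ p, A (σ p) p).degree < ((∑ p, ℓ p : ℕ) : WithBot ℕ) := by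
    intro σ hσ
    have hsign : (Equiv.Perm.sign σ • ∏ p, A (σ p) p).degree ≤ (∏ p, A (σ p) p).degree := by
      rcases Int.units_eq_one_or (Equiv.Perm.sign σ) with h | h
      · rw [h, one_smul]
      · rw [h, Units.neg_smul, one_smul, degree_neg]
    refine hsign.trans_lt ?_
    by_cases hzero : ∃ p, A (σ p) p = 0
    · obtain ⟨p, hp⟩ := hzero
      rw [Finset.prod_eq_zero (f := fun q => A (σ q) q) (Finset.mem_univ p) hp, degree_zero]
      exact WithBot.bot_lt_coe _
    · have hz : ∀ p, A (σ p) p ≠ 0 := fun p hp => hzero ⟨p, hp⟩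
      rw [degree_eq_natDegree (Finset.prod_ne_zero_iff.mpr fun p _ => hz p)]
      have hle : ∀ p, (A (σ p) p).natDegree ≤ ℓ (σ p) := by
        intro p
        by_cases hp : σ p = p
        · rw [hp]; exact (hmon p).2.le
        · exact Nat.le_of_lt ((natDegree_lt_iff_degree_lt (hz p)).mpr ((hA _ _).2 hp))
      obtain ⟨p₀, hp₀⟩ : ∃ p₀, σ p₀ ≠ p₀ := by
        by_contra hcon
        apply hσ
        refine Equiv.ext fun p => ?_
        by_contra hp
        exact hcon ⟨p, hp⟩
      have hlt : (A (σ p₀) p₀).natDegree < ℓ (σ p₀) :=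
        (natDegree_lt_iff_degree_lt (hz p₀)).mpr ((hA _ _).2 hp₀)
      have hnat : (∏ p, A (σ p) p).natDegree < ∑ p, ℓ p := by
        rw [natDegree_prod _ _ fun p _ => hz p]
        calc ∑ p, (A (σ p) p).natDegree < ∑ p, ℓ (σ p) :=
              Finset.sum_lt_sum (fun p _ => hle p) ⟨p₀, Finset.mem_univ _, hlt⟩
          _ = ∑ p, ℓ p := Equiv.sum_comp σ ℓ
      exact_mod_cast hnat
  -- hence the determinant is monic, in particular non-zero
  have hdet : A.det ≠ 0 := by
    rw [Matrix.det_apply, ← Finset.add_sum_erase _ _ (Finset.mem_univ (1 : Equiv.Perm (Nat.Partition N)))]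
    simp only [Equiv.Perm.sign_one, one_smul, Equiv.Perm.coe_one, id_eq]
    refine (hdiag_monic.add_of_left ?_).ne_zero
    rw [degree_eq_natDegree hdiag_monic.ne_zero, hdiag_deg]
    refine (degree_sum_le _ _).trans_lt ?_
    rw [Finset.sup_lt_iff (WithBot.bot_lt_coe _)]
    intro σ hσ
    exact hoff σ (Finset.ne_of_mem_erase hσ)
  -- choose `μ₀` off the (finitely many) roots
  obtain ⟨μ₀, hμ₀⟩ := Infinite.exists_notMem_finset A.det.roots.toFinset
  have hμ₀' : (A.det).eval μ₀ ≠ 0 := by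
    intro h
    apply hμ₀
    rw [Multiset.mem_toFinset, mem_roots hdet]
    exact h
  refine ⟨μ₀, ?_⟩
  have hdet' : ((Polynomial.evalRingHom μ₀).mapMatrix A).det ≠ 0 := by
    rw [← RingHom.map_det]
    exact hμ₀'
  -- coordinates of the specialised words on the monomials `x_𝕁`
  have hv : ∀ p, (rep (R := ℂ) 0 μ₀).partitionVector p 1 =
      MvPolynomial.map (Polynomial.aeval μ₀ : ℂ[X] →ₐ[ℂ] ℂ) (genRep.partitionVector p 1) :=
    fun p => (map_pbwVector_genRep μ₀ (lst p)).symm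
  rw [Fintype.linearIndependent_iff]
  intro g hg
  have hvec : Matrix.vecMul g ((Polynomial.evalRingHom μ₀).mapMatrix A) = 0 := by
    funext q
    have h1 := congrArg (MvPolynomial.coeff (mo q)) hg
    rw [MvPolynomial.coeff_sum, MvPolynomial.coeff_zero] at h1
    rw [Pi.zero_apply, ← h1, Matrix.vecMul, dotProduct]
    refine Finset.sum_congr rfl fun p _ => ?_
    rw [MvPolynomial.coeff_smul, smul_eq_mul, hv p, MvPolynomial.coeff_map, RingHom.mapMatrix_apply, Matrix.map_apply]
    rfl
  exact fun p => congrFun (Matrix.eq_zero_of_vecMul_eq_zero hdet' hvec) p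

end Fock

/-! ### The PBW theorem -/

namespace Verma

open MvPolynomial

/-- The vacuum component `⟨μ| · ⟩ : F → ℂ`, a linear form. [folklore] -/
def vacuumForm : Fock.Space ℂ →ₗ[ℂ] ℂ := MvPolynomial.lcoeff ℂ 0

/-- **PBW theorem for Verma modules over the Virasoro algebra (independence half)**: the ordered
monomials `e_𝕀 v_{c,h} = L_{-k₁} ⋯ L_{-k_j} v_{c,h}`, `𝕀 = (k₁ ≥ ⋯ ≥ k_j) ⊢ N`, are linearly
independent in `V(c,h)`, for every `c, h ∈ ℂ` and `N`.
[cite: IoharaKoga2011, §4.4.2 ("{e_𝕀.v_{c,h} | 𝕀 ∈ 𝒫ₙ} forms a basis of the weight subspace M(c,h)_{h+n}") and §1.2.5]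
[cite: KytolaRidout2009, §2 (the PBW basis of V_{h,c}, before eq. (2.8))] -/
theorem linearIndependent_partitionVector (c h : ℂ) (N : ℕ) :
    LinearIndependent ℂ fun p : Nat.Partition N => (rep c h).partitionVector p (hw c h) := by
  -- a generic Fock module `F₁ = F_0^{μ₀}` with independent words
  obtain ⟨μ₀, hind⟩ := Fock.exists_linearIndependent_partitionVector N
  set c₁ : ℂ := 1 - 12 * (0 : ℂ) ^ 2 with hc₁
  set h₁ : ℂ := μ₀ * (μ₀ - 2 * 0) / 2 with hh₁
  -- a Fock module `F₂ = F_{λ₂}^{μ₂}` of the complementary central charge and weight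
  obtain ⟨lam₂, hlam₂⟩ := IsAlgClosed.exists_eq_mul_self ((1 - (c - c₁)) / 12)
  obtain ⟨z, hz⟩ := IsAlgClosed.exists_eq_mul_self (lam₂ ^ 2 + 2 * (h - h₁))
  set mu₂ : ℂ := lam₂ + z with hmu₂
  have hc : c₁ + (1 - 12 * lam₂ ^ 2) = c := by
    rw [sq, ← hlam₂]; ring
  have hh : h₁ + mu₂ * (mu₂ - 2 * lam₂) / 2 = h := by
    have : mu₂ * (mu₂ - 2 * lam₂) = z * z - lam₂ ^ 2 := by rw [hmu₂]; ring
    rw [this, ← hz]; ring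
  let R₁ := Fock.rep (R := ℂ) 0 μ₀
  let R₂ := Fock.rep (R := ℂ) lam₂ mu₂
  let T := R₁.tensor R₂ c hc
  have hw : T.IsPrimary ((1 : Fock.Space ℂ) ⊗ₜ (1 : Fock.Space ℂ)) h := by
    have := VirasoroRep.IsPrimary.tmul (hc := hc) (Fock.isPrimary_one 0 μ₀) (Fock.isPrimary_one lam₂ mu₂)
    rwa [hh] at this
  -- the vacuum form kills the creation operators of `F₂` and is `1` on the vacuum
  have hε : ∀ k : ℕ, 0 < k → ∀ w, vacuumForm (R₂.L (-(k : ℤ)) w) = 0 := by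
    intro k hk w
    rw [vacuumForm, MvPolynomial.lcoeff_apply, Fock.rep_L_apply, ← MvPolynomial.constantCoeff_eq, Fock.constantCoeff_L_neg _ _ (by omega)]
  have hε1 : vacuumForm (1 : Fock.Space ℂ) = 1 := by
    rw [vacuumForm, MvPolynomial.lcoeff_apply, MvPolynomial.coeff_one, if_pos rfl]
  exact linearIndependent_partitionVector_of_isPrimary T hw
    (VirasoroRep.linearIndependent_partitionVector_tmul R₁ R₂ c hc vacuumForm hε hε1 hind)

/-- **`dim V(c,h)_{h+N} = p(N)`**: the character of the Verma module is `q^h / ∏_{n≥1} (1 - qⁿ)`.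
[cite: KytolaRidout2009, eq. (2.8)] [cite: IoharaKoga2011, §4.4.2]
[cite: DiFrancescoMathieuSenechal1997, eq. (7.10)] -/
theorem gradedDim_eq_card (c h : ℂ) (N : ℕ) :
    (rep c h).gradedDim (h + N) = Fintype.card (Nat.Partition N) := by
  rw [VirasoroRep.gradedDim, genWeightSpace_eq_levelSpace, VirasoroRep.levelSpace]
  exact finrank_span_eq_card (linearIndependent_partitionVector c h N)

/-- In particular the highest-weight vector of the Verma module is non-zero: `V(c,h) ≠ 0`.
[cite: IoharaKoga2011, §1.2.5] -/
theorem hw_ne_zero (c h : ℂ) : hw c h ≠ 0 := by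
  have h1 := (linearIndependent_partitionVector c h 0).ne_zero (Nat.Partition.indiscrete 0)
  rwa [VirasoroRep.partitionVector, show (Nat.Partition.indiscrete 0).parts = 0 by
    simp [Nat.Partition.indiscrete, Nat.Partition.ofSums], Multiset.sort_zero, List.reverse_nil,
    VirasoroRep.pbwVector_nil] at h1

/-- `V(c,h)` is a highest-weight module in the sense of Iohara–Koga Definition 1.16 (non-zero
generator). [cite: IoharaKoga2011, Definition 1.16 and §1.2.5] -/
theorem isHighestWeightModule (c h : ℂ) : (rep c h).IsHighestWeightModule (hw c h) h :=
  ⟨hw_ne_zero c h, isPrimary_hw, generated_hw_eq_top⟩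

end Verma

end Literature.RepresentationTheory.Virasoro

end
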